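import Summits.QuantumFields.BalabanUV.Beta.FP.PeriodisedSymBorderIndexWard
import Summits.QuantumFields.BalabanUV.Beta.FP.PeriodisedBorderWardContact
import Summits.QuantumFields.BalabanUV.Beta.SymRootedAveragingMatrix
import Summits.QuantumFields.BalabanUV.Beta.SymmetrisedAxialPotential
import Summits.QuantumFields.BalabanUV.Beta.FP.NestedStepLawTorusInstance

/-!
# `BalabanUV.Beta.FP.TorusSymGaugeCovariance` — road «FP» for binder row D1, ROUTE T, the dictionary's (J-a) «THE DOOR AT THE LITERAL OF RECORD (chart
# (III′))», item (α-1c) (LOCATED NEED behind an2's `JA-TABLE.v1.md` §1 `Q₁₀` slot; leaf-05 g29 INTENT 30: «the `c0` covariance rows … for the (0.4) border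
# are (COV)∕(α) rows — leaf-02's»): **THE TORUS MASTER IDENTITY FOR THE SHIFTED SPREAD `𝕄_j = bhKStepSh d N (Dsh N) j`** — the sym twin of
# gan24-leaf-05's `FP/TorusGaugeCovariance(Pairing∕Coarse)` MASTER `perF_bhKStepAt_mul_tgrad(_sum)` with the root `toSite r ↦ ρ_c = ctr (d+1) N`: the
# periodised (0.4) MEAN averaging of a torus pure gauge reads the gauge function AT THE CENTRED BLOCK ROOTS, with the SAME scalars `stepScale_j · #B`

WHAT.  §1 LATTICE: `bhKStepSh_Dsh_inr_inl_eq_smul` (the `(inr, inl)` border of `𝕄_j` is `stepScale_j ·` that of `bhK N + Dsh N`), the fluctuation-slot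
support `bhK_add_Dsh_inr_inl_eq_zero_of_not_mem` (an1's `symLinKerAt_eq_zero` through the dictionary), and **`tsum_bhK_add_Dsh_mul_dz`**:
`Σ'_z Σ_α (bhK N + Dsh N) x z (inr μ) (inl α) · dz ψ α z = [proj N x = 0] · #B · (ψ (x + ρ_c + N•e_μ) − ψ (x + ρ_c))` — an1's dictionary
`DshAn1.bhK_add_Dsh_inr_inl` (`= ((d+1)!)⁻¹ · symLinAvgAt ρ_c (δ_{(α,z)}) N μ (quo N x)` at coarse `x`), leaf-03's `SymRootedAveragingMatrix.hasSum_symLinAvgAt_delta1`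
(the functional is represented by its matrix) and an1's `SymmetrisedAxialPotential.symLinAvgAt_grad` (`= (d+1)!·#B·(f(root′) − f(root))`), all BY NAME.  §2 TORUS
(box `M`): `summable_bhKStepSh_Dsh_inr_inl_mul`, **`perF_bhKStepSh_Dsh_mul_tgrad`** (EXACTLY `perF_bhKStepAt_mul_tgrad`'s shape: `Σ_q perF M 𝕄_j (p, inr κ) q ·
tgrad M q s = stepScale_j · [proj N p = 0] · #B · (tdelta M (p + ρ_c + N•e_κ) s − tdelta M (p + ρ_c) s)`, via my g17 `PeriodisedBorderWardContact.sum_perZ_mul_tgrad`),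
**`perF_bhKStepSh_Dsh_mul_tgrad_sum`** (paired with any gauge function), (C1) **`perF_bhKStepSh_Dsh_mul_tgrad_of_not_root`** (non-root columns of the CENTRED comb
are killed, `N ∣ M i`).  §3 (C2) **`perF_bhKStepSh_Dsh_coarsePt_mul_tgradBlock`** on `fine N M′`: `Q₁₀ · D₂ = stepScale_j · #B · tgrad M′` — the SAME normalisation as
the rooted chart (`ρ_c` drops out), so the (β) door's `c0 ∕ d0 ∕ h2 ∕ b*` sockets take the rooted `D̄` shape verbatim; also the input of the `q1` twin
(`PeriodisedSymCompositeIndexWard.torus_symQ10_mul_tgrad_fun`).  [folklore] re-indexing of finitely supported period sums BY NAME; no `def`, no `def … : Prop`,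
nothing cited, 0 sorry.  Nothing of the dictionary ∕ Bałaban's asserted (that `𝕄_j` IS the literal's bordered Hessian is an2's TABLE).

HONEST DEPENDENCY (page 1, mandatory): continuum YM on T⁴ ⇐ BetaPertH ∧ nine spine estimates (0/9 proved); BetaPertH ⇐ (D1) ∧ (D4) ∧ CAP+tail;
G-an2-4 gates asym, D1 and NE2/3/4.  HONEST FRAMING (cell contract, verbatim): «discharging `BetaPertH` makes Bałaban's UV stability UNCONDITIONAL —
a real constructive-QFT result; it is NOT the continuum limit and NOT the Clay problem.»  ABSOLUTE RULE (cell charter, verbatim): «No internally-minted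
statement may enter as a cited fact. Every hypothesis is either kernel-proved in this package or a verbatim quotation of a PUBLISHED theorem with page
reference. The manuscript(s) under audit are NOT citable for their own disputed steps — they are the thing under adjudication; programme-internal
(2001/route/tribunal) claims are never citable.»  0 estimates; 0∕4 row-D1 binders; NOT (T-ID), NOT (J-a) complete, NOT SDF, NOT D1, NOT BetaPertH, NOT
continuum, NOT Clay.  D1 formalisation swarm LEAF PROVER 02 (b2b-balaban-beta-d1-formalise-leaf-02 gen 21), 2026-08-22.  No existing file touched.
-/

noncomputable section

open scoped BigOperators Nat

namespace Summit.QuantumFields.BalabanUV.Beta.FP.TorusSymGaugeCovariance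

open Finset
open Literature.Probability.LatticeModels (Torus.proj)
open Literature.MathematicalPhysics.QuantumFieldTheory.Balaban1983to89
open Literature.MathematicalPhysics.QuantumFieldTheory.Balaban1983to89.Beta
open Literature.MathematicalPhysics.QuantumFieldTheory.LatticeForm (quo)
open ExpKernelCalculus (MKer)
open B6Lemma24Torus (pbox mem_pbox)
open AffineAveraging (Site box toSite unitVec dz Form1)
open AveragingContours (grad grad_eq_dz)
open AveragingContoursRooted (ctr ctrOff ctrOff_mem_box)
open AveragingHessianKernels (Near)
open KKTFluctuationKernel (delta1)
open OneStepResolventKernel (Fib eq_zsmul_quo_of_proj)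
open Summit.QuantumFields.BalabanUV.Beta.BorderedHessian (stepScale bhK bhKStep_succ_inr_inl)
open Summit.QuantumFields.BalabanUV.Beta.DshAn1 (Dsh bhK_add_Dsh_inr_inl)
open Summit.QuantumFields.BalabanUV.Beta.SymAveragingHessianCounts (symLinKerAt_eq_zero symLinKerAt_eq_symLinAvgAt)
open Summit.QuantumFields.BalabanUV.Beta.SymShiftedSpread (bhKStepSh bhKStepSh_apply bhKStepSh_zero)
open Summit.QuantumFields.BalabanUV.Beta.SymRootedAveragingMatrix (hasSum_symLinAvgAt_delta1)
open Summit.QuantumFields.BalabanUV.Beta.SymmetrisedAxialPotential (symLinAvgAt symLinAvgAt_grad)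
open Summit.QuantumFields.BalabanUV.Beta.FP.KernelPeriodisationFib (Idx perF perF_apply perZ perZ_apply)
open Summit.QuantumFields.BalabanUV.Beta.FP.TorusGaugeCovariance (tdelta tgrad tgrad_inr nearBox mem_nearBox sum_mul_tgrad_eq_sum_inl tdelta_eq_zero_of_root
  proj_sub_eq_zero_of_zsmul_add)
open Summit.QuantumFields.BalabanUV.Beta.FP.TorusGaugeCovariancePairing (wrapPt sum_tdelta_mul)
open Summit.QuantumFields.BalabanUV.Beta.FP.TorusGaugeCovarianceCoarse (tgradBlock tgradBlock_inr tgradBlock_eq_sum_tgrad_mul coarsePt coarsePt_coe proj_coarsePt tdelta_quo_wrapPt quo_zsmul_add_toSite')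
open B5Prop11Plancherel (fine)
open Summit.QuantumFields.BalabanUV.Beta.FP.PeriodisedBorderWardContact (sum_perZ_mul_tgrad)
open Summit.QuantumFields.BalabanUV.Beta.FP.TorusCombRows (Res ne_rootOf_iff_proj_ne)
open Summit.QuantumFields.BalabanUV.Beta.GAN24.FineReadoutCauchyFrame (toSite_mem_range)
open Summit.QuantumFields.BalabanUV.Beta.FP.NestedStepLawTorusInstance (submatrix_field_mul dvd_fine)

variable {d : ℕ}

/-! ## §1 Lattice: the shifted spread's averaging row against a pure gauge reads the gauge function AT THE CENTRED BLOCK ROOTS -/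

section Lattice

variable (N : ℕ) [NeZero N]

/-- [folklore] the `(inr, inl)` entry of the shifted straight spread at level `j` is `stepScale d N j ·` that of `bhK N + Dsh N` (`bhKStep (j+1) =
stepScale (j+1)·bhK` on the border; `stepScale 0 = 1`). -/
theorem bhKStepSh_Dsh_inr_inl_eq_smul (j : ℕ) (x z : Site (d + 1)) (μ α : Fin (d + 1)) :
    bhKStepSh d N (Dsh N) j x z (Sum.inr μ) (Sum.inl α) = stepScale d N j * (bhK N + Dsh (d := d) N : MKer (d + 1) (Fib d)) x z (Sum.inr μ) (Sum.inl α) := by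
  cases j with
  | zero => rw [bhKStepSh_zero, stepScale, pow_zero, one_pow, one_mul]
  | succ j =>
    rw [bhKStepSh_apply, Pi.add_apply, Pi.add_apply, Pi.add_apply, Pi.add_apply, Pi.smul_apply, Pi.smul_apply, Pi.smul_apply, Pi.smul_apply, smul_eq_mul,
      bhKStep_succ_inr_inl, Pi.add_apply, Pi.add_apply, Pi.add_apply, Pi.add_apply]
    ring

/-- [folklore] the `(inr μ, inl α)` entries of `bhK N + Dsh N` at the first slot `x` are supported in the near box of the block of `x`
(`symLinKerAt_eq_zero` through an1's dictionary `bhK_add_Dsh_inr_inl`). -/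
theorem bhK_add_Dsh_inr_inl_eq_zero_of_not_mem (x : Site (d + 1)) (μ α : Fin (d + 1)) {z : Site (d + 1)} (hz : z ∉ nearBox N (quo N x)) :
    (bhK N + Dsh (d := d) N : MKer (d + 1) (Fib d)) x z (Sum.inr μ) (Sum.inl α) = 0 := by
  have hN : 1 ≤ N := Nat.one_le_iff_ne_zero.mpr (NeZero.ne N)
  rw [mem_nearBox] at hz
  rw [bhK_add_Dsh_inr_inl]
  split_ifs with hx
  · have h0 := symLinKerAt_eq_zero (μ := μ) (y := quo N x) (ctrOff_mem_box hN) (f := (α, z)) hz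
    rw [symLinKerAt_eq_symLinAvgAt] at h0
    have hL : ((N : ℝ) ^ (d + 1))⁻¹ ≠ 0 := inv_ne_zero (pow_ne_zero _ (Nat.cast_ne_zero.2 (NeZero.ne N)))
    have hf : (((d + 1) ! : ℝ))⁻¹ ≠ 0 := inv_ne_zero (Nat.cast_ne_zero.2 (Nat.factorial_ne_zero _))
    rcases mul_eq_zero.1 h0 with h | h
    · exact absurd h hL
    rcases mul_eq_zero.1 h with h | h
    · exact absurd h hf
    rw [show ctr (d + 1) N = toSite (ctrOff (d + 1) N) from rfl, show delta1 α z = (fun κ x => if κ = (α, z).1 ∧ x = (α, z).2 then (1 : ℝ) else 0) from rfl, h,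
      mul_zero]
  · rfl

/-- [folklore] **LATTICE MASTER IDENTITY FOR THE SHIFTED SPREAD** (the sym twin of an1's `linAvgAt_grad`, periodisation-free): the `(inr μ, inl ·)` row of
`bhK N + Dsh N` at `x` against the lattice gradient of a potential `ψ` is `[proj N x = 0] · #B · (ψ (x + ρ_c + N•e_μ) − ψ (x + ρ_c))` — the (0.4) mean
averaging of a pure gauge READS THE GAUGE FUNCTION AT THE CENTRED BLOCK ROOTS (`DshAn1.bhK_add_Dsh_inr_inl` = `((d+1)!)⁻¹ · symLinAvgAt ρ_c (δ) N μ (quo x)`;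
an1∕leaf-03's `hasSum_symLinAvgAt_delta1` (the functional is represented by its matrix); an1's `symLinAvgAt_grad`). -/
theorem tsum_bhK_add_Dsh_mul_dz (x : Site (d + 1)) (μ : Fin (d + 1)) (ψ : Site (d + 1) → ℝ) :
    ∑' z : Site (d + 1), ∑ α : Fin (d + 1), (bhK N + Dsh (d := d) N : MKer (d + 1) (Fib d)) x z (Sum.inr μ) (Sum.inl α) * dz ψ α z
      = if Torus.proj N x = 0 then
          ((box (d + 1) N).card : ℝ) * (ψ (x + ctr (d + 1) N + (N : ℤ) • unitVec μ) - ψ (x + ctr (d + 1) N)) else 0 := by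
  have hN : 1 ≤ N := Nat.one_le_iff_ne_zero.mpr (NeZero.ne N)
  have hf : (((d + 1) ! : ℝ)) ≠ 0 := Nat.cast_ne_zero.2 (Nat.factorial_ne_zero _)
  by_cases hx : Torus.proj N x = 0
  · rw [if_pos hx]
    have hent : ∀ z : Site (d + 1), ∑ α : Fin (d + 1), (bhK N + Dsh (d := d) N : MKer (d + 1) (Fib d)) x z (Sum.inr μ) (Sum.inl α) * dz ψ α z
        = (((d + 1) ! : ℝ))⁻¹ * ∑ α : Fin (d + 1), symLinAvgAt (toSite (ctrOff (d + 1) N)) (delta1 α z) N μ (quo N x) * grad ψ α z := fun z => by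
      rw [Finset.mul_sum]
      refine Finset.sum_congr rfl fun α _ => ?_
      rw [bhK_add_Dsh_inr_inl, if_pos hx, grad_eq_dz, mul_assoc]
      rfl
    rw [tsum_congr hent, tsum_mul_left, (hasSum_symLinAvgAt_delta1 hN (ctrOff_mem_box hN) (grad ψ) μ (quo N x)).tsum_eq, symLinAvgAt_grad,
      ← mul_assoc, ← mul_assoc, inv_mul_cancel₀ hf, one_mul]
    congr 1
    rw [show ((N : ℤ) • quo N x) = x from (eq_zsmul_quo_of_proj hx).symm]
    rfl
  · rw [if_neg hx]
    refine (tsum_congr fun z => ?_).trans tsum_zero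
    refine Finset.sum_eq_zero fun α _ => ?_
    rw [bhK_add_Dsh_inr_inl, if_neg hx, zero_mul]

end Lattice

/-! ## §2 Torus: the MASTER identity for the periodised shifted spread, and its (C1) ∕ (C2) corollaries -/

section Torus

variable (M : Fin (d + 1) → ℕ) [∀ μ, NeZero (M μ)] {N : ℕ} [NeZero N]

omit [∀ μ, NeZero (M μ)] in
/-- [folklore] the `(inr μ, inl α)` row of the shifted spread at `x` times any function is summable in the fluctuation slot (finite support). -/
theorem summable_bhKStepSh_Dsh_inr_inl_mul (j : ℕ) (x : Site (d + 1)) (μ α : Fin (d + 1)) (g : Site (d + 1) → ℝ) :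
    Summable fun z => bhKStepSh d N (Dsh N) j x z (Sum.inr μ) (Sum.inl α) * g z :=
  summable_of_ne_finset_zero (s := nearBox N (quo N x)) fun z hz => by
    rw [bhKStepSh_Dsh_inr_inl_eq_smul, bhK_add_Dsh_inr_inl_eq_zero_of_not_mem N x μ α hz, mul_zero, zero_mul]

/-- [folklore] **TORUS MASTER IDENTITY FOR THE SHIFTED SPREAD `𝕄_j = bhKStepSh d N (Dsh N) j`** (the sym twin of gan24-leaf-05's
`TorusGaugeCovariance.perF_bhKStepAt_mul_tgrad`, root `toSite r ↦ ρ_c = ctr (d+1) N`): every multiplier row `(p, inr κ)` of the periodised spread against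
the torus gradient columns = `stepScale d N j · [proj N p = 0] · #B · (tdelta M (p + ρ_c + N•e_κ) s − tdelta M (p + ρ_c) s)` — the periodised (0.4) MEAN
averaging of a torus pure gauge is `#B` times the COARSE gradient of the gauge function's values AT THE CENTRED BLOCK ROOTS. -/
theorem perF_bhKStepSh_Dsh_mul_tgrad (j : ℕ) (p : ↥(pbox M)) (κ : Fin (d + 1)) (s : ↥(pbox M)) :
    ∑ q : Idx M (Fib d), perF M (bhKStepSh d N (Dsh N) j) (p, Sum.inr κ) q * tgrad M q s
      = stepScale d N j *
          (if Torus.proj N (p : Site (d + 1)) = 0 then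
            ((box (d + 1) N).card : ℝ) *
              (tdelta M ((p : Site (d + 1)) + ctr (d + 1) N + (N : ℤ) • unitVec κ) s - tdelta M ((p : Site (d + 1)) + ctr (d + 1) N) s)
           else 0) := by
  rw [sum_mul_tgrad_eq_sum_inl]
  simp only [perF_apply]
  rw [sum_perZ_mul_tgrad M (bhKStepSh d N (Dsh N) j) (p : Site (d + 1)) κ s (fun α g => summable_bhKStepSh_Dsh_inr_inl_mul j _ κ α g)]
  have hent : ∀ z : Site (d + 1), ∑ α : Fin (d + 1), bhKStepSh d N (Dsh N) j (p : Site (d + 1)) z (Sum.inr κ) (Sum.inl α) * dz (fun w => tdelta M w s) α z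
      = stepScale d N j * ∑ α : Fin (d + 1), (bhK N + Dsh (d := d) N : MKer (d + 1) (Fib d)) (p : Site (d + 1)) z (Sum.inr κ) (Sum.inl α)
          * dz (fun w => tdelta M w s) α z := fun z => by
    rw [Finset.mul_sum]
    exact Finset.sum_congr rfl fun α _ => by rw [bhKStepSh_Dsh_inr_inl_eq_smul, mul_assoc]
  rw [tsum_congr hent, tsum_mul_left, tsum_bhK_add_Dsh_mul_dz]

/-- [folklore] **… PAIRED WITH ANY GAUGE FUNCTION `c` ON THE BOX** (sym twin of `perF_bhKStepAt_mul_tgrad_sum`): the pairing evaluates `c` at the box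
representatives of the two centred roots — `stepScale_j · [proj N p = 0] · #B · (c (wrapPt M (p + ρ_c + N•e_κ)) − c (wrapPt M (p + ρ_c)))`. -/
theorem perF_bhKStepSh_Dsh_mul_tgrad_sum (j : ℕ) (p : ↥(pbox M)) (κ : Fin (d + 1)) (c : ↥(pbox M) → ℝ) :
    ∑ s : ↥(pbox M), (∑ q : Idx M (Fib d), perF M (bhKStepSh d N (Dsh N) j) (p, Sum.inr κ) q * tgrad M q s) * c s
      = stepScale d N j *
          (if Torus.proj N (p : Site (d + 1)) = 0 then
            ((box (d + 1) N).card : ℝ) *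
              (c (wrapPt M ((p : Site (d + 1)) + ctr (d + 1) N + (N : ℤ) • unitVec κ)) - c (wrapPt M ((p : Site (d + 1)) + ctr (d + 1) N)))
           else 0) := by
  simp only [perF_bhKStepSh_Dsh_mul_tgrad M]
  split_ifs with hp
  · simp only [mul_sub, sub_mul, Finset.sum_sub_distrib, mul_assoc, ← Finset.mul_sum, sum_tdelta_mul]
  · simp only [mul_zero, zero_mul, Finset.sum_const_zero]

/-- [folklore] **(C1) FOR THE SHIFTED SPREAD**: every multiplier row of the periodised spread KILLS the torus gradient column of a NON-root site of the
CENTRED comb (`N ∣ M i`; root `ρ_c`) — sym twin of `perF_bhKStepAt_mul_tgrad_of_not_root`. -/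
theorem perF_bhKStepSh_Dsh_mul_tgrad_of_not_root (hM : ∀ i, N ∣ M i) (j : ℕ) (p : ↥(pbox M)) (κ : Fin (d + 1)) {s : ↥(pbox M)}
    (hs : Torus.proj N ((s : Site (d + 1)) - ctr (d + 1) N) ≠ 0) :
    ∑ q : Idx M (Fib d), perF M (bhKStepSh d N (Dsh N) j) (p, Sum.inr κ) q * tgrad M q s = 0 := by
  rw [perF_bhKStepSh_Dsh_mul_tgrad M]
  split_ifs with hp
  · have h1 : Torus.proj N ((p : Site (d + 1)) + ctr (d + 1) N + (N : ℤ) • unitVec κ - ctr (d + 1) N) = 0 := by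
      rw [show (p : Site (d + 1)) + ctr (d + 1) N + (N : ℤ) • unitVec κ = (N : ℤ) • (quo N (p : Site (d + 1)) + unitVec κ) + ctr (d + 1) N by
        rw [smul_add, ← eq_zsmul_quo_of_proj hp]; abel]
      exact proj_sub_eq_zero_of_zsmul_add _ _ _
    have h2 : Torus.proj N ((p : Site (d + 1)) + ctr (d + 1) N - ctr (d + 1) N) = 0 := by
      rw [show (p : Site (d + 1)) + ctr (d + 1) N = (N : ℤ) • quo N (p : Site (d + 1)) + ctr (d + 1) N by rw [← eq_zsmul_quo_of_proj hp]]
      exact proj_sub_eq_zero_of_zsmul_add _ _ _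
    rw [tdelta_eq_zero_of_root M hM h1 hs, tdelta_eq_zero_of_root M hM h2 hs, sub_zero, mul_zero, mul_zero]
  · rw [mul_zero]

end Torus

/-! ## §3 (C2) for the shifted spread: the block-constant modes descend to `stepScale_j · #B ·` the COARSE torus gradient -/

section Coarse

variable (M' : Fin (d + 1) → ℕ) [∀ μ, NeZero (M' μ)] {N : ℕ} [NeZero N]

/-- [folklore] **MASTER-COARSE FOR THE SHIFTED SPREAD** (sym twin of gan24-leaf-05's `perF_bhKStepAt_coarsePt_mul_tgradBlock`): on the fine box `fine N M′`,
`Σ_q perF (fine N M′) 𝕄_j (N•p̄, inr κ) q · tgradBlock M′ N q t = stepScale d N j · #B · tgrad M′ (p̄, inl κ) t` — **`Q₁₀ · D₂ = stepScale·#B · D̄₀`** with the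
UNNORMALISED coarse gradient `D̄₀ = tgrad M′` (the centred root offset `ρ_c` drops out: both roots lie in the blocks `p̄ + e_κ` resp. `p̄`). -/
theorem perF_bhKStepSh_Dsh_coarsePt_mul_tgradBlock (j : ℕ) (p : ↥(pbox M')) (κ : Fin (d + 1)) (t : ↥(pbox M')) :
    ∑ q : Idx (fine N M') (Fib d), perF (fine N M') (bhKStepSh d N (Dsh N) j) (coarsePt M' N p, Sum.inr κ) q * tgradBlock M' N q t
      = stepScale d N j * (((box (d + 1) N).card : ℝ) * tgrad M' (p, Sum.inl κ) t) := by
  have hN : 1 ≤ N := Nat.one_le_iff_ne_zero.mpr (NeZero.ne N)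
  have hx : ∑ q : Idx (fine N M') (Fib d), perF (fine N M') (bhKStepSh d N (Dsh N) j) (coarsePt M' N p, Sum.inr κ) q * tgradBlock M' N q t
      = ∑ s : ↥(pbox (fine N M')), (∑ q : Idx (fine N M') (Fib d),
          perF (fine N M') (bhKStepSh d N (Dsh N) j) (coarsePt M' N p, Sum.inr κ) q * tgrad (fine N M') q s) * tdelta M' (quo N (s : Site (d + 1))) t := by
    simp only [tgradBlock_eq_sum_tgrad_mul, Finset.mul_sum, Finset.sum_mul, mul_assoc]
    exact Finset.sum_comm
  rw [hx, perF_bhKStepSh_Dsh_mul_tgrad_sum (fine N M') j (coarsePt M' N p) κ _, if_pos (proj_coarsePt M' N p), tdelta_quo_wrapPt,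
    tdelta_quo_wrapPt, coarsePt_coe, TorusGaugeCovariance.tgrad_inl, show ctr (d + 1) N = toSite (ctrOff (d + 1) N) from rfl,
    show (N : ℤ) • (p : Site (d + 1)) + toSite (ctrOff (d + 1) N) + (N : ℤ) • unitVec κ = (N : ℤ) • ((p : Site (d + 1)) + unitVec κ) + toSite (ctrOff (d + 1) N) by
      rw [smul_add]; abel,
    quo_zsmul_add_toSite' (ctrOff_mem_box hN), quo_zsmul_add_toSite' (ctrOff_mem_box hN)]

end Coarse

/-! ## §4 The (β) door's covariance sockets at the (III′) tables: `h₁ : Q₁₀·D₁ = 0`, `h₂ : Q₁₀·D₂ = D̄`, `d0 : Q₂₀·D̄ = 0` (sym twins of `torus_cov₁ ∕ _cov₂ ∕ _cov₀'`) -/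

section Sockets

variable (M' : Fin (d + 1) → ℕ) [∀ μ, NeZero (M' μ)] {Lc : ℕ} [NeZero Lc] {r' : Fin (d + 1) → ℕ}

/-- [folklore] **`h₁ : Q₁₀·D₁ = 0` AT THE (III′) TORUS CALL** (sym twin of `NestedStepLawTorusInstance.torus_cov₁`): the shifted spread's multiplier rows kill the
torus gradients of the non-root indicators of the CENTRED comb on the fine box. -/
theorem torus_sym_cov₁ (j : ℕ) :
    (perF (fine Lc M') (bhKStepSh d Lc (Dsh Lc) j)).submatrix
          (fun a : ↥(pbox M') × Fin (d + 1) => ((coarsePt M' Lc a.1, Sum.inr a.2) : Idx (fine Lc M') (Fib d)))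
          (fun b : ↥(pbox (fine Lc M')) × Fin (d + 1) => ((b.1, Sum.inl b.2) : Idx (fine Lc M') (Fib d)))
        * (tgrad (fine Lc M')).submatrix (fun b : ↥(pbox (fine Lc M')) × Fin (d + 1) => ((b.1, Sum.inl b.2) : Idx (fine Lc M') (Fib d)))
            (fun s : Res (ctr (d + 1) Lc) Lc (fine Lc M') => (s.1 : ↥(pbox (fine Lc M')))) = 0 := by
  have hLc : 0 < Lc := Nat.pos_of_ne_zero (NeZero.ne Lc)
  have hLc1 : 1 ≤ Lc := hLc
  rw [submatrix_field_mul (fine Lc M') _ _ (tgrad_inr (fine Lc M'))]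
  ext a x
  rw [Matrix.submatrix_apply, Matrix.mul_apply, Matrix.zero_apply]
  exact perF_bhKStepSh_Dsh_mul_tgrad_of_not_root (fine Lc M') (dvd_fine M') j _ a.2
    ((ne_rootOf_iff_proj_ne hLc (toSite_mem_range (ctrOff_mem_box hLc1)) _).1 x.2)

/-- [folklore] **`h₂ : Q₁₀·D₂ = D̄` AT THE (III′) TORUS CALL** (sym twin of `torus_cov₂`): the shifted spread's multiplier rows send the block-constant modes to
`(stepScale_j·#B)` times the coarse torus gradients (the rooted `D̄` shape VERBATIM). -/
theorem torus_sym_cov₂ (j : ℕ) :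
    (perF (fine Lc M') (bhKStepSh d Lc (Dsh Lc) j)).submatrix
          (fun a : ↥(pbox M') × Fin (d + 1) => ((coarsePt M' Lc a.1, Sum.inr a.2) : Idx (fine Lc M') (Fib d)))
          (fun b : ↥(pbox (fine Lc M')) × Fin (d + 1) => ((b.1, Sum.inl b.2) : Idx (fine Lc M') (Fib d)))
        * (tgradBlock M' Lc).submatrix (fun b : ↥(pbox (fine Lc M')) × Fin (d + 1) => ((b.1, Sum.inl b.2) : Idx (fine Lc M') (Fib d)))
            (fun t : Res (toSite r') Lc M' => (t.1 : ↥(pbox M')))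
      = Matrix.of fun (a : ↥(pbox M') × Fin (d + 1)) (t : Res (toSite r') Lc M') =>
          stepScale d Lc j * (((box (d + 1) Lc).card : ℝ) * tgrad M' (a.1, Sum.inl a.2) t.1) := by
  rw [submatrix_field_mul (fine Lc M') _ _ (tgradBlock_inr M' Lc)]
  ext a t
  rw [Matrix.submatrix_apply, Matrix.mul_apply, Matrix.of_apply]
  exact perF_bhKStepSh_Dsh_coarsePt_mul_tgradBlock M' j a.1 a.2 t.1

/-- [folklore] **`d0 : Q₂₀·D̄ = 0` ONE LEVEL UP AT THE (III′) TABLES** (sym twin of `NestedStepLawTorusInstanceDelta.torus_cov₀'`): the level-`k` shifted spread's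
rows on the coarse box `M′` (coarse multiplier slots `a ↦ (pμ′ a, inr (mμ′ a))`, `Lc ∣ M′ i`) kill `stepScale_j·#B·tgrad M′` read on the residual parameters of the
CENTRED coarse comb. -/
theorem torus_sym_cov₀' (hM' : ∀ i, Lc ∣ M' i) (j k : ℕ) {κ : Type*} (pμ' : κ → ↥(pbox M')) (mμ' : κ → Fin (d + 1)) :
    (perF M' (bhKStepSh d Lc (Dsh Lc) k)).submatrix (fun a : κ => ((pμ' a, Sum.inr (mμ' a)) : Idx M' (Fib d)))
          (fun b : ↥(pbox M') × Fin (d + 1) => ((b.1, Sum.inl b.2) : Idx M' (Fib d)))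
        * Matrix.of (fun (a : ↥(pbox M') × Fin (d + 1)) (t : Res (ctr (d + 1) Lc) Lc M') =>
            stepScale d Lc j * (((box (d + 1) Lc).card : ℝ) * tgrad M' (a.1, Sum.inl a.2) t.1)) = 0 := by
  have hLc : 0 < Lc := Nat.pos_of_ne_zero (NeZero.ne Lc)
  have hLc1 : 1 ≤ Lc := hLc
  ext a t
  rw [Matrix.zero_apply, Matrix.mul_apply]
  have hC := perF_bhKStepSh_Dsh_mul_tgrad_of_not_root M' hM' k (pμ' a) (mμ' a)
    ((ne_rootOf_iff_proj_ne hLc (toSite_mem_range (ctrOff_mem_box hLc1)) _).1 t.2)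
  rw [sum_mul_tgrad_eq_sum_inl, ← Fintype.sum_prod_type'] at hC
  rw [Finset.sum_congr rfl fun (b : ↥(pbox M') × Fin (d + 1)) _ =>
      show (perF M' (bhKStepSh d Lc (Dsh Lc) k)).submatrix (fun a : κ => ((pμ' a, Sum.inr (mμ' a)) : Idx M' (Fib d)))
            (fun b : ↥(pbox M') × Fin (d + 1) => ((b.1, Sum.inl b.2) : Idx M' (Fib d))) a b
          * Matrix.of (fun (a : ↥(pbox M') × Fin (d + 1)) (t : Res (ctr (d + 1) Lc) Lc M') =>
              stepScale d Lc j * (((box (d + 1) Lc).card : ℝ) * tgrad M' (a.1, Sum.inl a.2) t.1)) b t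
        = perF M' (bhKStepSh d Lc (Dsh Lc) k) (pμ' a, Sum.inr (mμ' a)) (b.1, Sum.inl b.2) * tgrad M' (b.1, Sum.inl b.2) t.1
          * (stepScale d Lc j * ((box (d + 1) Lc).card : ℝ)) by
        rw [Matrix.submatrix_apply, Matrix.of_apply]; ring,
    ← Finset.sum_mul, hC, zero_mul]

end Sockets

end Summit.QuantumFields.BalabanUV.Beta.FP.TorusSymGaugeCovariance

end
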